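import Mathlib

/-!
# `SnSubsetDichotomy.HyperoctahedralThreshold` — a poor host family, I: word-matrix algebra

Support file for crux `stmt-MatrixMultiplication-10883` (line `refutation-local-symmetry`,
siege on `stub_poorRigidCore`).  It supplies the algebra behind an explicit infinite family of
hosts (three fixed-point-free involutions of `Fin n`) in which EVERY cyclically reduced colour
word `z` has at most `2|z| · N₀` fixed points (`N₀ = Θ(n^{2/3})`), while the word `[0, 1]` has a
pattern class of size `N₀` — see the companion files `…PoorHostModel` and `…PoorHostFamily`.

Algebra (over any field `F`).  The three involutions of a fibre are the images of
`U g := T g * S * T (-g) = !![g, -(g²+1); 1, -g]` (`S = !![0,-1;1,0]`, `T g = !![1,g;0,1]`) for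
`g ∈ {0, X, -X} ⊂ F[X]`.  For a word `w = c₁ ⋯ c_ℓ` the product `U_{c₁} ⋯ U_{c_ℓ}` equals
`T g₁ * (R h₁ * ⋯ * R h_{ℓ-1}) * S * T (-g_ℓ)` with `R h = S * T h = !![0,-1;1,h]` and
`hᵢ = g_{i+1} - gᵢ` (`Wpoly_sandwich`), so its trace is the trace of the cyclic continuant
`R h₁ ⋯ R h_ℓ`, `h_ℓ = g₁ - g_ℓ` (`trace_Wpoly`).  When `w` is cyclically reduced every `hᵢ` has
degree `1` (needs `2 ≠ 0`), and the continuant degree invariant (`inv_prod`) shows that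
this trace has degree exactly `ℓ` (`degree_trace_Wpoly`).  Also three small arithmetic lemmas
used by the family file.  Everything here is [folklore] linear algebra.
-/

namespace Summit.MatrixMultiplication.MatrixMultiplication.Theorems.HyperoctahedralThreshold

namespace PoorHost

open Polynomial Matrix

section Continuant

variable {F : Type*} [Field F]

/-- The matrix `R h = S * T h = !![0, -1; 1, h]`. -/
noncomputable def Rm (h : F[X]) : Matrix (Fin 2) (Fin 2) F[X] := !![0, -1; 1, h]

/-- The half-turn `S = !![0, -1; 1, 0]`. -/
noncomputable def Sm : Matrix (Fin 2) (Fin 2) F[X] := !![0, -1; 1, 0]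

/-- The translation `T g = !![1, g; 0, 1]`. -/
noncomputable def Tm (g : F[X]) : Matrix (Fin 2) (Fin 2) F[X] := !![1, g; 0, 1]

/-- The conjugated half-turn `U g = T g * S * T (-g) = !![g, -(g ^ 2 + 1); 1, -g]`. -/
noncomputable def Um (g : F[X]) : Matrix (Fin 2) (Fin 2) F[X] := !![g, -(g ^ 2 + 1); 1, -g]

/-- `U g = T g * S * T (-g)`. [folklore] -/
theorem Um_eq (g : F[X]) : Um g = Tm g * Sm * Tm (-g) := by
  ext i j
  fin_cases i <;> fin_cases j <;>
    simp [Um, Tm, Sm, Matrix.mul_apply, Fin.sum_univ_two]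
  ring_nf

/-- `T a * T b = T (a + b)`. [folklore] -/
theorem Tm_mul_Tm (a b : F[X]) : Tm a * Tm b = Tm (a + b) := by
  ext i j
  fin_cases i <;> fin_cases j <;>
    simp [Tm, Matrix.mul_apply, Fin.sum_univ_two, add_comm]

/-- `S * T h = R h`. [folklore] -/
theorem Sm_mul_Tm (h : F[X]) : Sm * Tm h = Rm h := by
  ext i j
  fin_cases i <;> fin_cases j <;>
    simp [Tm, Sm, Rm, Matrix.mul_apply, Fin.sum_univ_two]

/-- `T a * (T b * Y) = T (a + b) * Y`. [folklore] -/
theorem Tm_mul_Tm_assoc (a b : F[X]) (Y : Matrix (Fin 2) (Fin 2) F[X]) :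
    Tm a * (Tm b * Y) = Tm (a + b) * Y := by
  rw [← Matrix.mul_assoc, Tm_mul_Tm]

/-- `S * (T h * Y) = R h * Y`. [folklore] -/
theorem Sm_mul_Tm_assoc (h : F[X]) (Y : Matrix (Fin 2) (Fin 2) F[X]) :
    Sm * (Tm h * Y) = Rm h * Y := by
  rw [← Matrix.mul_assoc, Sm_mul_Tm]

/-- `det (U g) = 1`. [folklore] -/
theorem det_Um (g : F[X]) : (Um g).det = 1 := by
  simp [Um, Matrix.det_fin_two]; ring_nf

/-- `U g * U g = -1` (so `U g` is an involution projectively). [folklore] -/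
theorem Um_mul_Um (g : F[X]) : Um g * Um g = -1 := by
  ext i j
  fin_cases i <;> fin_cases j <;>
    simp [Um, Matrix.mul_apply, Fin.sum_univ_two] <;> ring_nf

/-- Base case of the continuant degree invariant (the `(1,1)` entry of a product of `k`
matrices `R hᵢ`, `deg hᵢ = 1`, has degree exactly `k`, the other entries less): `k = 1`.
[folklore] -/
theorem inv_single (h : F[X]) (hh : h.degree = 1) :
    ((Rm h) 0 0).degree < (1 : ℕ) ∧ ((Rm h) 0 1).degree < (1 : ℕ) ∧
      ((Rm h) 1 0).degree < (1 : ℕ) ∧ ((Rm h) 1 1).degree = (1 : ℕ) :=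
  ⟨by simp [Rm], by simp [Rm], by simp [Rm], by simpa [Rm] using hh⟩

/-- Inductive step of the continuant degree invariant. [folklore] -/
theorem inv_step (h : F[X]) (hh : h.degree = 1) (N : Matrix (Fin 2) (Fin 2) F[X]) (k : ℕ)
    (d00 : (N 0 0).degree < k) (d01 : (N 0 1).degree < k) (d10 : (N 1 0).degree < k)
    (d11 : (N 1 1).degree = k) :
    ((Rm h * N) 0 0).degree < (k + 1 : ℕ) ∧ ((Rm h * N) 0 1).degree < (k + 1 : ℕ) ∧
      ((Rm h * N) 1 0).degree < (k + 1 : ℕ) ∧ ((Rm h * N) 1 1).degree = (k + 1 : ℕ) := by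
  have e00 : (Rm h * N) 0 0 = -N 1 0 := by simp [Rm, Matrix.mul_apply, Fin.sum_univ_two]
  have e01 : (Rm h * N) 0 1 = -N 1 1 := by simp [Rm, Matrix.mul_apply, Fin.sum_univ_two]
  have e10 : (Rm h * N) 1 0 = N 0 0 + h * N 1 0 := by
    simp [Rm, Matrix.mul_apply, Fin.sum_univ_two]
  have e11 : (Rm h * N) 1 1 = N 0 1 + h * N 1 1 := by
    simp [Rm, Matrix.mul_apply, Fin.sum_univ_two]
  have hk : ((k : ℕ) : WithBot ℕ) < (k + 1 : ℕ) := by exact_mod_cast Nat.lt_succ_self k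
  refine ⟨?_, ?_, ?_, ?_⟩
  · rw [e00, Polynomial.degree_neg]
    exact lt_trans d10 hk
  · rw [e01, Polynomial.degree_neg, d11]
    exact hk
  · rw [e10]
    refine lt_of_le_of_lt (Polynomial.degree_add_le _ _) (max_lt (lt_trans d00 hk) ?_)
    rw [Polynomial.degree_mul, hh]
    calc (1 : WithBot ℕ) + (N 1 0).degree < 1 + (k : WithBot ℕ) :=
          WithBot.add_lt_add_left (by simp) d10
      _ = ((k + 1 : ℕ) : WithBot ℕ) := by push_cast; ring
  · rw [e11]
    have hdeg : (h * N 1 1).degree = ((k + 1 : ℕ) : WithBot ℕ) := by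
      rw [Polynomial.degree_mul, hh, d11]; push_cast; ring
    rw [Polynomial.degree_add_eq_right_of_degree_lt, hdeg]
    rw [hdeg]
    exact lt_trans d01 hk

/-- The continuant degree invariant for a nonempty product of `R hᵢ`, `deg hᵢ = 1`.
[folklore] -/
theorem inv_prod (hs : List F[X]) (hne : hs ≠ []) (hdeg : ∀ h ∈ hs, h.degree = 1) :
    (((hs.map Rm).prod) 0 0).degree < hs.length ∧ (((hs.map Rm).prod) 0 1).degree < hs.length ∧
      (((hs.map Rm).prod) 1 0).degree < hs.length ∧
        (((hs.map Rm).prod) 1 1).degree = hs.length := by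
  induction hs with
  | nil => exact absurd rfl hne
  | cons h hs ih =>
    rcases hs with _ | ⟨h', hs'⟩
    · simpa using inv_single h (hdeg h (by simp))
    · obtain ⟨d00, d01, d10, d11⟩ :=
        ih (by simp) (fun x hx => hdeg x (List.mem_cons_of_mem _ hx))
      simpa using inv_step h (hdeg h (by simp)) _ _ d00 d01 d10 d11

/-- The trace of a nonempty continuant product has degree equal to its length. [folklore] -/
theorem degree_trace_prod (hs : List F[X]) (hne : hs ≠ []) (hdeg : ∀ h ∈ hs, h.degree = 1) :
    ((hs.map Rm).prod).trace.degree = hs.length := by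
  obtain ⟨d00, -, -, d11⟩ := inv_prod hs hne hdeg
  rw [Matrix.trace_fin_two, Polynomial.degree_add_eq_right_of_degree_lt] <;> rw [d11]
  exact d00

/-- The colour polynomials `0, X, -X`. -/
noncomputable def gcol : Fin 3 → F[X] := ![0, X, -X]

/-- Consecutive differences of the colour polynomials along a word. -/
noncomputable def diffs : List (Fin 3) → List F[X]
  | [] => []
  | [_] => []
  | c :: c' :: w => (gcol c' - gcol c) :: diffs (c' :: w)

/-- `diffs` of a word of length `ℓ ≥ 1` has length `ℓ - 1`. -/
theorem length_diffs (c : Fin 3) (w : List (Fin 3)) :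
    (diffs (F := F) (c :: w)).length = w.length := by
  induction w generalizing c with
  | nil => rfl
  | cons c' w ih => simp [diffs, ih]

/-- Distinct colours have colour polynomials differing by a nonzero multiple of `X`
(needs `2 ≠ 0`). -/
theorem gcol_sub_eq (h2 : (2 : F) ≠ 0) {c c' : Fin 3} (hcc : c ≠ c') :
    ∃ k : F, k ≠ 0 ∧ (gcol c' - gcol c : F[X]) = C k * X := by
  have hX2 : ((X : F[X]) - -X) = C (2 : F) * X := by rw [map_ofNat]; ring
  have hX2' : (-(X : F[X]) - X) = C (-2 : F) * X := by rw [map_neg, map_ofNat]; ring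
  have hX1 : (-(X : F[X]) - 0) = C (-1 : F) * X := by rw [map_neg, map_one]; ring
  have hX1' : ((0 : F[X]) - X) = C (-1 : F) * X := by rw [map_neg, map_one]; ring
  have hX0 : ((X : F[X]) - 0) = C (1 : F) * X := by rw [map_one]; ring
  have hX0' : ((0 : F[X]) - -X) = C (1 : F) * X := by rw [map_one]; ring
  have h1 : (-1 : F) ≠ 0 := neg_ne_zero.mpr one_ne_zero
  fin_cases c <;> fin_cases c' <;> simp only [gcol, Fin.zero_eta, Fin.mk_one, Fin.reduceFinMk,
    Matrix.cons_val_zero, Matrix.cons_val_one, Matrix.cons_val, ne_eq, not_true_eq_false,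
    Fin.isValue] at hcc ⊢
  · exact ⟨1, one_ne_zero, hX0⟩
  · exact ⟨-1, h1, hX1⟩
  · exact ⟨-1, h1, hX1'⟩
  · exact ⟨-2, neg_ne_zero.mpr h2, hX2'⟩
  · exact ⟨1, one_ne_zero, hX0'⟩
  · exact ⟨2, h2, hX2⟩

/-- Distinct colours have colour polynomials whose difference has degree `1`. -/
theorem degree_gcol_sub (h2 : (2 : F) ≠ 0) {c c' : Fin 3} (hcc : c ≠ c') :
    (gcol c' - gcol c : F[X]).degree = 1 := by
  obtain ⟨k, hk, hkk⟩ := gcol_sub_eq h2 hcc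
  rw [hkk]
  exact Polynomial.degree_C_mul_X hk

/-- Along a reduced word all consecutive differences have degree `1`. -/
theorem diffs_degree (h2 : (2 : F) ≠ 0) (w : List (Fin 3)) (hw : List.IsChain (· ≠ ·) w) :
    ∀ h ∈ diffs (F := F) w, h.degree = 1 := by
  induction w with
  | nil => simp [diffs]
  | cons c w ih =>
    rcases w with _ | ⟨c', w'⟩
    · simp [diffs]
    · rw [List.isChain_cons_cons] at hw
      intro h hh
      simp only [diffs, List.mem_cons] at hh
      rcases hh with rfl | hh
      · exact degree_gcol_sub h2 hw.1
      · exact ih hw.2 h hh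

/-- The polynomial word matrix `U_{c₁} ⋯ U_{c_ℓ}` of a word `[c₁, …, c_ℓ]`. -/
noncomputable def Wpoly (w : List (Fin 3)) : Matrix (Fin 2) (Fin 2) F[X] :=
  (w.map fun c => Um (gcol c)).prod

/-- The empty word matrix is `1`. -/
theorem Wpoly_nil : Wpoly (F := F) [] = 1 := by simp [Wpoly]

/-- `Wpoly (c :: w) = U_c * Wpoly w`. -/
theorem Wpoly_cons (c : Fin 3) (w : List (Fin 3)) :
    Wpoly (F := F) (c :: w) = Um (gcol c) * Wpoly w := by simp [Wpoly]

/-- Word matrices have determinant `1`. -/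
theorem det_Wpoly (w : List (Fin 3)) : (Wpoly (F := F) w).det = 1 := by
  induction w with
  | nil => simp [Wpoly_nil]
  | cons c w ih => rw [Wpoly_cons, Matrix.det_mul, det_Um, ih, one_mul]

/-- Sandwich form of the word matrix: `T g₁ * ∏ R hᵢ * S * T (-g_ℓ)`. [folklore] -/
theorem Wpoly_sandwich (c : Fin 3) (w : List (Fin 3)) :
    Wpoly (F := F) (c :: w) =
      Tm (gcol c) * ((diffs (c :: w)).map Rm).prod * Sm *
        Tm (-(gcol ((c :: w).getLast (List.cons_ne_nil c w)))) := by
  induction w generalizing c with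
  | nil => simp [Wpoly, diffs, Um_eq]
  | cons c' w ih =>
    rw [Wpoly_cons, ih c']
    have hl : (c :: c' :: w).getLast (List.cons_ne_nil c (c' :: w)) =
        (c' :: w).getLast (List.cons_ne_nil c' w) := List.getLast_cons_cons
    rw [hl, Um_eq]
    simp only [diffs, List.map_cons, List.prod_cons, Matrix.mul_assoc]
    rw [Tm_mul_Tm_assoc, Sm_mul_Tm_assoc, neg_add_eq_sub]

/-- The trace of the word matrix is the trace of a cyclic continuant product. [folklore] -/
theorem trace_Wpoly (c : Fin 3) (w : List (Fin 3)) :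
    (Wpoly (F := F) (c :: w)).trace =
      (((diffs (c :: w)) ++ [gcol c - gcol ((c :: w).getLast (List.cons_ne_nil c w))]).map
        Rm).prod.trace := by
  rw [Wpoly_sandwich, Matrix.mul_assoc, Matrix.mul_assoc, Matrix.trace_mul_comm]
  simp only [List.map_append, List.map_cons, List.map_nil, List.prod_append, List.prod_cons,
    List.prod_nil, Matrix.mul_one, Matrix.mul_assoc]
  rw [Tm_mul_Tm, Sm_mul_Tm, neg_add_eq_sub]

/-- **Key algebraic fact.** For a nonempty cyclically reduced colour word `w` the trace of its
word matrix is a polynomial of degree exactly `|w|` (in characteristic `≠ 2`). [folklore] -/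
theorem degree_trace_Wpoly (h2 : (2 : F) ≠ 0) (w : List (Fin 3)) (hw : w ≠ [])
    (hc : List.IsChain (· ≠ ·) (w ++ w)) :
    (Wpoly (F := F) w).trace.degree = w.length := by
  obtain ⟨c, w', rfl⟩ := List.exists_cons_of_ne_nil hw
  rw [trace_Wpoly]
  have hchain : List.IsChain (· ≠ ·) (c :: w') := hc.left_of_append
  have hcyc : (c :: w').getLast (List.cons_ne_nil c w') ≠ c := by
    simpa using hc.rel_getLast_head_of_append (List.cons_ne_nil c w') (List.cons_ne_nil c w')
  rw [degree_trace_prod]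
  · simp [length_diffs]
  · simp
  · intro h hh
    rw [List.mem_append, List.mem_singleton] at hh
    rcases hh with hh | rfl
    · exact diffs_degree h2 _ hchain h hh
    · exact degree_gcol_sub h2 hcyc

/-- Registered stub `stub_continuantTraceDegree` of crux `stmt-MatrixMultiplication-10883` (this file's
ticket): the trace of a nonempty product of continuant matrices `!![0, -1; 1, hᵢ]`, `deg hᵢ = 1`, has
degree equal to its length (`degree_trace_prod`, restated without local definitions). [folklore] -/
theorem stub_continuantTraceDegree : ∀ (F : Type) [Field F] (hs : List (Polynomial F)), hs ≠ [] → (∀ h ∈ hs, h.degree = 1) → ((hs.map fun h => !![(0 : Polynomial F), -1; 1, h]).prod).trace.degree = hs.length :=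
  fun _ _ hs hne hdeg => degree_trace_prod hs hne hdeg

end Continuant

section Arithmetic

/-- `a ^ k ≤ b ^ j` gives `a ≤ b ^ (j / k)` for real powers. [folklore] -/
theorem cast_le_rpow_of_pow_le {a b k j : ℕ} (hk : k ≠ 0) (h : a ^ k ≤ b ^ j) :
    (a : ℝ) ≤ (b : ℝ) ^ ((j : ℝ) / (k : ℝ)) := by
  have ha : (0 : ℝ) ≤ a := Nat.cast_nonneg a
  calc (a : ℝ) = ((a : ℝ) ^ k) ^ ((k : ℝ)⁻¹) := (Real.pow_rpow_inv_natCast ha hk).symm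
    _ ≤ ((b : ℝ) ^ j) ^ ((k : ℝ)⁻¹) :=
        Real.rpow_le_rpow (by positivity) (by exact_mod_cast h) (by positivity)
    _ = (b : ℝ) ^ ((j : ℝ) / (k : ℝ)) := by
        rw [div_eq_mul_inv, Real.rpow_mul (Nat.cast_nonneg b), Real.rpow_natCast]

/-- The numerical slack between `2ℓ N` and the poorness bound `(4ℓ²)^(⌊log₂ ℓ⌋+1) (N/8 + 1)`. -/
theorem arith_bound (ℓ N : ℕ) (hℓ : 2 ≤ ℓ) :
    2 * ℓ * N ≤ (4 * ℓ ^ 2) ^ (Nat.log 2 ℓ + 1) * (N / 8 + 1) := by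
  have hk : 1 ≤ Nat.log 2 ℓ := Nat.log_pos one_lt_two hℓ
  have hN : N < 8 * (N / 8 + 1) := Nat.lt_mul_div_succ N (by norm_num)
  have hpow : (4 * ℓ ^ 2) ^ 2 ≤ (4 * ℓ ^ 2) ^ (Nat.log 2 ℓ + 1) :=
    Nat.pow_le_pow_right (by positivity) (by omega)
  have hℓ4 : ℓ ≤ ℓ ^ 4 := Nat.le_self_pow (by norm_num) ℓ
  calc 2 * ℓ * N ≤ 2 * ℓ * (8 * (N / 8 + 1)) := Nat.mul_le_mul_left _ hN.le
    _ = 16 * ℓ * (N / 8 + 1) := by ring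
    _ ≤ 16 * ℓ ^ 4 * (N / 8 + 1) := by gcongr
    _ = (4 * ℓ ^ 2) ^ 2 * (N / 8 + 1) := by ring
    _ ≤ (4 * ℓ ^ 2) ^ (Nat.log 2 ℓ + 1) * (N / 8 + 1) := Nat.mul_le_mul_right _ hpow

/-- A nonempty cyclically reduced word has length `≥ 2`. [folklore] -/
theorem two_le_length_of_cyclic {α : Type*} (z : List α) (hz : z ≠ [])
    (hc : List.IsChain (· ≠ ·) (z ++ z)) : 2 ≤ z.length := by
  rcases z with _ | ⟨a, _ | ⟨b, t⟩⟩
  · exact absurd rfl hz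
  · simp at hc
  · simp

end Arithmetic

end PoorHost

end Summit.MatrixMultiplication.MatrixMultiplication.Theorems.HyperoctahedralThreshold
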